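import Summits.BirchSwinnertonDyer.BirchSwinnertonDyer.Theorems.AdditiveBranchIMCGordTwoRankOneClassForm
import Summits.BirchSwinnertonDyer.Rank1Residual.Additive.DisegniLineEndStateThreeIntrinsic
import Summits.BirchSwinnertonDyer.Rank1Residual.Additive.N10IsogenyTransport
import Summits.BirchSwinnertonDyer.Rank1Residual.X12.CMIsogenyInvariance
import Literature.NumberTheory.EllipticCurves.IsogenyIdProofs
import HarnessLib

/-!
# Route `AdditiveBranchIMC` (rung K1), crux `GordTwoRankOne` (item 19358): the `p = 3` rows ANOMALOUS OR
# NOT, the Case-1 rows by Cassels transport, and THE CRUX SHAPE modulo its displayed inputs (cell `bsd-addord`,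
# seat `bsd-addord-k1-c3`, D-0074 row B2; `--supports stmt-BirchSwinnertonDyer-19358 --as helper`; fourth file
# after `…GordTwoRankOne{OffCaseOne,OddBranch,ClassForm}.lean`)

HONEST FRAMING. THEOREMS ONLY: no definition, no named fact, no `sorry`, nothing booked; BSD is not proved by
any of this and the crux stays OPEN at class level (Λ-adic branch lower containment off the Case-1 rows NOT
in print; `p`-adic height non-degeneracy = the per-class certificate). This file (i) removes the `p = 3`
non-anomalous hypothesis of `…ClassForm.lean` §1 by lit's `p = 3` conjoined fact in the (B♮) currency
(`Disegni2017.delbourgoDatum_cycLineGrossZagier_intrinsicThree`, `hCyc3`; Delbourgo 2002 Thm. (B) under the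
Hypothesis' SECOND bullet with `ℓ_3(E)` read as `[E(ℚ₃) : N_∞E(ℚ₃)]/c₃`, never evaluated) + Mazur 1972
Cor. 5.15 (`hMaz`), exactly as the gz seat's `DisegniLineEndStateThreeIntrinsic` (p420003) does on X3;
(ii) ASSEMBLES the Case-1 rows of cell (G-ord, `e = 2`) in analytic rank one — the gz seat's kernel end states
on the Case-1 MEMBER (`ClassX3Gord.bsdp_rankOne_of_facts_of_cycLineFact_intrinsic_of_branchCoeffOneNeZero{,Odd}`,
p414600 / p417124; `ClassX3Gord.bsdp_three_rankOne_of_facts_of_cycLineFactThree_intrinsic_of_lineDatum_of_branchCoeffOneNeZero`,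
p420003) followed by Cassels' isogeny invariance (`N10.missingLowerBoundAt_of_isIsogenous_of_bsdp`, fact
`hCassels`) — the rank-one twin of the route's closed support item `X3CaseOneRankZero`; (iii) takes the union
with the off-Case-1 class form.

* §0 `p = 3`, hna-free: `exists_datum_identity_three_intrinsic_of_facts`,
  `cellGordTwo_missingLowerBoundAt_rankOne_three_intrinsic_of_facts_of_chiBranchLowerOdd_of_branchCoeffOneNeZero`
  (∀ `N10.CellGordTwo W 3` row, non-CM, ANOMALOUS OR NOT, `r_an = 1`: `MissingLowerBoundAt W 3` from published
  facts + per-pair `ChiBranchLowerDivisibilityOddAt W 3` + `BranchCoeffOneNeZeroAt W 3`), and the all-odd-`p`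
  off-Case-1 class form WITHOUT the `p = 3` anomalous exclusion
  (`gordTwoRankOne_offCaseOne_of_facts_intrinsic_of_chiBranchLower_of_branchCoeffOneNeZero`).
* §1 `gordTwoRankOne_caseOne_of_facts_of_classCert` — ∀ `W p`, `r_an = 1 → N10.CellGordTwo W p → ¬CM →
  [A′ ≠ 0 on the isogeny class] → HasCaseOneMember W p → MissingLowerBoundAt W p`, from PUBLISHED facts only.
  The certificate is taken on the CLASS (`∀ W′ ~ W, BranchCoeffOneNeZeroAt W′ p`): it is consumed at the Case-1
  member, where the cell's two-engine bundles compute it (HOME/proof/gz4, gz5-p3).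
* §2 **`gordTwoRankOne_of_facts_of_chiBranchLower_of_classCert`** — THE CRUX SHAPE: published facts →
  [Λ-adic branch lower containment DISPLAYED on the off-Case-1 slice, per parity: `hΛ`, `hΛ'` — NOT in print]
  → ∀ `W p`, `r_an = 1 → N10.CellGordTwo W p → ¬CM → [A′ ≠ 0 on the class] → MissingLowerBoundAt W p`.
  Against the route decl `GordTwoRankOne` the residual inputs are EXACTLY: the rank-free Λ-adic layer of crux
  `GordTwoRankZeroOffCaseOne` (items 19244/19245), `p`-adic height non-degeneracy in certificate form
  (Schneider, rider I1 — H3: not attacked), and the CM rows.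

References: [Delbourgo2002] Thm. (A), (B), Hypothesis p. 39, p. 67 (iv), p. 69; [Disegni2017] Thm. A, B;
[Mazur1972Towers] Cor. 5.15; [GreenbergVatsal2000] §2, Thm. (3.12); [Wuthrich2014] Thm. 16; [MilneADT2006]
Thm. I.7.3 (Cassels); [SkinnerUrban2014] Cor. 3.6.3 / Thm. 3.6.4 (shape only); [Miller2011LMS] Def. 1.1;
cell TARGET.md E39, row B2.
-/

set_option autoImplicit false
set_option linter.dupNamespace false

noncomputable section

open scoped Classical MatrixGroups ModularForm NumberField

open CongruenceSubgroup WeierstrassCurve NumberField IsDedekindDomain Field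
  Literature.NumberTheory.EllipticCurves Literature.NumberTheory.EllipticCurves.ModularForms
  Literature.NumberTheory.EllipticCurves.GreenbergVatsal2000
  Literature.NumberTheory.EllipticCurves.Rank1Residual
  Literature.NumberTheory.EllipticCurves.Rank1Residual.Typed
  Literature.NumberTheory.EllipticCurves.Delbourgo2002
  Literature.NumberTheory.EllipticCurves.Disegni2017
  Literature.NumberTheory.GaloisRepresentations
  Summit.BirchSwinnertonDyer.Rank1Residual.AdditivePotMult
  Summit.BirchSwinnertonDyer.Rank1Residual.Additive
  Summit.BirchSwinnertonDyer.Rank1Residual.X12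

namespace Summit.BirchSwinnertonDyer.BirchSwinnertonDyer.Theorems.AdditiveBranchIMCGordTwoRankOne

/-! ### §0 `p = 3`, ANOMALOUS OR NOT: the (B♮) currency at `3` (lit's `…_intrinsicThree`) + Mazur Cor. 5.15 -/

section Three

variable {W : WeierstrassCurve ℚ} [W.IsElliptic] [W.IsGloballyMinimal]

/-- **The MINUS-branch identity at a given triple, `p = 3`, with the datum in BOTH currencies** —
`exists_datum_identity_three_of_facts` with lit's fact (B) replaced by its `p = 3` (B♮) twin `hCyc3`
(`Disegni2017.delbourgoDatum_cycLineGrossZagier_intrinsicThree`: Hypothesis second bullet, the good ordinary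
quadratic twist supplied by `TypeGOrd.exists_goodOrd_twist_model_three`): `Dh` with
`LeadingTermClausesIntrinsic W 3 Dh ∧ LeadingTermClauses W 3 Dh` and the identity
`ϖ·[T¹]L_3⁻(f, α_V, ω)·log_3 γ = u·q·Reg_3(E,Dh)`, `L′(E,1) = q·Ω_E·Reg_∞`. Chain = gz's p420003 verbatim, its X3
hypothesis being idle. [cite: Disegni2017, Theorem A (arXiv v3 PDF pp. 7–8), Theorem B (PDF p. 9)]
[cite: Delbourgo2002, Theorem (B) (p. 40), p. 67 (iv), p. 69; Hypothesis (p. 39) second bullet]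
[cite: GrossZagier1986, Thm. I.(7.3)] [cite: Darmon2004, §3.9, proof of Thm. 3.22] [cite: MazurTateTeitelbaum1986Invent, §I.13] -/
theorem exists_datum_identity_three_intrinsic_of_facts [hp : Fact (Nat.Prime 3)]
    (hCyc3 : delbourgoDatum_cycLineGrossZagier_intrinsicThree)
    (hArt : rankinSelbergEulerProductHecke_baseChangeDirichlet_eq) (h73 : GrossZagier1986_thm_I_7_3)
    (hWald : waldspurger_exists_heegnerField_twist_ne_zero)
    (hmod : hasEntireLFunction_rat) (hmodD : nonempty_modularParametrizationData)
    (hmodN : exists_isNewformOf) (hGZK : rank_eq_analyticRank_of_analyticRank_le_one)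
    (haddv : Addv W 3) (hG : TypeGOrd W 3) (hcm : ¬ W.HasCM) (hr : W.analyticRank = 1)
    (V : WeierstrassCurve ℚ) [V.IsElliptic] [V.IsGloballyMinimal] (C : VariableChange ℚ)
    (hV : GoodOrd V 3) (hC : C • V.quadraticTwist ((-1 : ℚ) ^ ((3 : ℕ) / 2) * (3 : ℕ)) = W)
    {N : ℕ} [NeZero N] {f : CuspForm (Gamma0 N) 2} (hf : IsNewformOf V f)
    (ϖ : ℚ) (hϖ : (ϖ : ℝ) * V.imaginaryPeriodRat = minusPeriod f) :
    ∃ Dh : PAdicHeightData W 3, LeadingTermClausesIntrinsic W 3 Dh ∧ LeadingTermClauses W 3 Dh ∧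
      ∃ (u : ℤ_[3]ˣ) (q : ℚ),
        W.leadingLCoeff = (q : ℂ) * (W.realPeriodRat : ℂ) * (W.regulator : ℂ) ∧
        (ϖ : ℚ_[3]) *
            PowerSeries.coeff 1 (padicLFunctionMinusBranch f ((unitRoot V 3 : ℤ_[3]) : ℚ_[3]) ((3 : ℕ) / 2)) *
            padicLog 3 (cyclotomicGenerator 3) =
          ((u : ℤ_[3]) : ℚ_[3]) * (q : ℚ_[3]) * padicRegulator Dh := by
  -- adapted from gz's `ClassX3Gord.bsdp_three_rankOne_of_facts_of_cycLineFactThree_intrinsic_of_branchCoeffOneNeZero`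
  have hpP : (3 : ℕ).Prime := hp.out
  have hp4 : (3 : ℕ) % 4 = 3 := by norm_num
  have hps : ((-1 : ℚ) ^ ((3 : ℕ) / 2) * ((3 : ℕ) : ℚ)) = -((3 : ℕ) : ℚ) := by norm_num
  have hC' : C • V.quadraticTwist (-((3 : ℕ) : ℚ)) = W := by rw [← hps]; exact hC
  have hVW : ∃ C : VariableChange ℚ, C • V.quadraticTwist (-((3 : ℕ) : ℚ)) = W := ⟨C, hC'⟩
  have hordin : IsOrdinaryAt V 3 := ⟨hV.1, hV.2⟩
  haveI : NeZero (W.conductorNorm ℤ) := ⟨(W.conductorNorm_pos_holds).ne'⟩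
  obtain ⟨DmW⟩ := hmodD W
  -- the Heegner field with `L(E^{(d_K)}, 1) ≠ 0` (Waldspurger)
  have hroot : W.rootNumber = -1 := by
    rcases rootNumber_eq_one_or_eq_neg_one W with h1 | h1
    · exfalso
      have hev1 : Even W.analyticRank :=
        (even_analyticRank_iff_rootNumber_eq_one_of_exists_isNewformOf W hmodN).mpr h1
      rw [hr] at hev1
      exact Nat.not_even_one hev1
    · exact h1
  obtain ⟨K, _, _, hK, -, hHeeg, hLd⟩ := hWald W hroot 0
  have h2 : Module.finrank ℚ K = 2 := hK.1
  haveI : IsGalois ℚ K := isGalois_of_finrank_eq_two K h2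
  have hdq : (NumberField.discr K : ℚ) ≠ 0 := by exact_mod_cast NumberField.discr_ne_zero K
  -- the Kronecker character and the twist data
  obtain ⟨κ, hκ, hκ2, hκall⟩ := exists_kroneckerChar_twistCoeff K h2
  obtain ⟨hpd, hκW, V', iV', iVm', N', _, f', hfV', hV', hap, hordV'⟩ :=
    exists_twist_newform_neg K hmodD hmodN hp4 h2 κ hκ hκall hHeeg haddv V hVW hV hf
  have hpdN : Nat.Coprime 3 (NumberField.discr K).natAbs :=
    (Nat.Prime.coprime_iff_not_dvd hpP).mpr fun h ↦ hpd (Int.natCast_dvd.mpr h)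
  have hS' : legendreMinusSymbolSum f' 3 ≠ 0 :=
    legendreMinusSymbolSum_ne_zero_of_twist K hmod hp4 κ hκW haddv V hVW hf hfV'.1
      hfV'.coeffField_eq_bot hV' hLd
  have hrd : (W.quadraticTwist (NumberField.discr K : ℚ)).mordellWeilRank = 0 := by
    haveI := W.isElliptic_quadraticTwist hdq
    have h0 : (W.quadraticTwist (NumberField.discr K : ℚ)).analyticRank = 0 :=
      (analyticRank_eq_zero_iff_holds (hmod _)).mpr hLd
    rw [(hGZK _ (by rw [h0]; exact zero_le_one)).1, h0]
  -- the datum, in both currencies: the `p = 3` conjoined fact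
  obtain ⟨ι⟩ := PadicAlgCl.nonempty_ringEquiv_complex (p := 3)
  have hpstar : ((pStar 3 : ℤ) : ℚ) = -((3 : ℕ) : ℚ) := by rw [pStar]; norm_num
  have hCps : C • V.quadraticTwist (pStar 3 : ℚ) = W := by rw [hpstar]; exact hC'
  obtain ⟨Dh, DhK, hres, hBι, hB, hGZc⟩ := hCyc3.exists_datum_intrinsic_three ι rfl hcm haddv hG
    (hG.exists_goodOrd_twist_model_three haddv) hr hCps (Or.inl ⟨hV.1, hordin, rfl⟩) DmW.isNewformOf hK
    hHeeg
  -- STEP C⁻(2): the identity at `(V, f, ϖ)`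
  obtain ⟨u, q, hlead, hpgz⟩ := branchPAdicGrossZagier_identity_of_cycLine_odd ι K hp4 hArt h73 hmod hGZK
    h2 κ hκ hκ2 hpdN hrd haddv hr V V' C hC' hV hordV' hap hf DmW.isNewformOf hfV' hV' hS' ϖ hϖ hres hGZc
  exact ⟨Dh, hBι, hB, u, q, hlead, hpgz⟩

/-- **Cell (G-ord, `e = 2`) at `p = 3` (Gord3), `E` non-CM, ANOMALOUS OR NOT, `r_an(E) = 1`, ANY residual
image: the LOWER half `ord_3 #Ш(E)_an ≤ ord_3 #Ш(E)` from PUBLISHED named facts (`hMaz`, `hCyc3`, `hArt`,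
`h73`, `hWald`, `hDel3`, modularity, GZK) + TWO typed per-pair inputs** `ChiBranchLowerDivisibilityOddAt W 3`
(NOT in print off the Case-1 rows) and `BranchCoeffOneNeZeroAt W 3`. The hna-free twin of
`cellGordTwo_missingLowerBoundAt_rankOne_three_of_facts_…` (`…ClassForm.lean`): §0 identity, Schneider
(`…_odd`), `cycLowerBoundAt_of_chiBranchLowerOdd_of_identity`, Delbourgo (A) at `3`, the unit factors at
`𝔭 ∣ 3` (`UniversalNormTwist.not_dvd_localUniversalNormIndex_of_goodOrd_twist`),
`missingLowerBoundAt_of_cycLowerBound_of_not_dvd_index`. [cite: Delbourgo2002, Theorem (A), (B) (p. 40), p. 67 (iv), p. 69]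
[cite: Mazur1972Towers, Cor. 5.15 with Remark (p. 229)] [cite: Disegni2017, Theorem A/B (arXiv v3 PDF 7–9)]
[cite: MazurTateTeitelbaum1986Invent, §I.13] [cite: Miller2011LMS, Def. 1.1] -/
theorem cellGordTwo_missingLowerBoundAt_rankOne_three_intrinsic_of_facts_of_chiBranchLowerOdd_of_branchCoeffOneNeZero
    [hp : Fact (Nat.Prime 3)] (hMaz : Mazur1972.cor515_universalNormIndex)
    (hCyc3 : delbourgoDatum_cycLineGrossZagier_intrinsicThree)
    (hArt : rankinSelbergEulerProductHecke_baseChangeDirichlet_eq) (h73 : GrossZagier1986_thm_I_7_3)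
    (hWald : waldspurger_exists_heegnerField_twist_ne_zero) (hDel3 : Delbourgo2002.mainTheorem_three)
    (hmod : hasEntireLFunction_rat) (hmodD : nonempty_modularParametrizationData)
    (hmodN : exists_isNewformOf) (hGZK : rank_eq_analyticRank_of_analyticRank_le_one)
    (hc : N10.CellGordTwo W 3) (hcm : ¬ W.HasCM) (hr : W.analyticRank = 1)
    (hdiv : ChiBranchLowerDivisibilityOddAt W 3) (hne : BranchCoeffOneNeZeroAt W 3) :
    MissingLowerBoundAt W 3 := by
  obtain ⟨hp2, haddv, hG, he⟩ := hc
  have hp4 : (3 : ℕ) % 4 = 3 := by norm_num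
  obtain ⟨V, iV, iVm, C, hV, hC⟩ := TypeGOrd.exists_goodOrd_pStar_twist_model W 3 hp2 hG haddv he
  have hps : ((-1 : ℚ) ^ ((3 : ℕ) / 2) * ((3 : ℕ) : ℚ)) = -((3 : ℕ) : ℚ) := by norm_num
  have hVW : ∃ C : VariableChange ℚ, C • V.quadraticTwist (-((3 : ℕ) : ℚ)) = W :=
    ⟨C, by rw [← hps]; exact hC⟩
  haveI : NeZero (V.conductorNorm ℤ) := ⟨(V.conductorNorm_pos_holds).ne'⟩
  obtain ⟨Dm⟩ := hmodD V
  obtain ⟨ϖ, -, hϖ⟩ := exists_rat_mul_imaginaryPeriodRat_eq_minusPeriod Dm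
  obtain ⟨Dh, hBι, -, u, q, hlead, hpgz⟩ := exists_datum_identity_three_intrinsic_of_facts hCyc3 hArt h73
    hWald hmod hmodD hmodN hGZK haddv hG hcm hr V C hV hC Dm.isNewformOf ϖ hϖ
  -- the two unit factors at the place over `3` (Mazur 1972 via the twist transport)
  set v₀ : HeightOneSpectrum (𝓞 ℚ) := (Rat.HeightOneSpectrum.primesEquiv (R := 𝓞 ℚ)).symm ⟨3, hp.out⟩
    with hv₀_def
  have hv₀ : ((3 : ℕ) : 𝓞 ℚ) ∈ v₀.asIdeal :=
    natCast_mem_asIdeal_of_primesEquiv_eq (primesEquiv_symm_apply_coe 3)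
  have hcp0 : W.tamagawaNumberAt v₀ ≠ 0 := (tamagawaNumberAt_ne_zero_and_le_four_of_addv W 3 haddv).1
  have hι : ∀ κ : ZpExtension ℚ 3, κ.IsCyclotomic →
      localUniversalNormIndex (W := W) (v₀.adicCompletion ℚ) κ ⊤ ≠ 0 →
      ¬ 3 ∣ localUniversalNormIndex (W := W) (v₀.adicCompletion ℚ) κ ⊤ :=
    fun κ hκ h0 ↦ UniversalNormTwist.not_dvd_localUniversalNormIndex_of_goodOrd_twist V W κ v₀ hMaz hp2
      hV.1 (by exact_mod_cast hV.2) hκ hv₀ hC h0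
  -- (S), the lower factorisation, the lower half (intrinsic currency)
  have hSch : SchneiderConjecture Dh :=
    schneiderConjecture_of_identity_of_branchCoeffOneNeZero_odd hp4 hne V C hC ⟨hV.1, hV.2⟩ Dm.f
      Dm.isNewformOf ϖ hϖ hpgz
  have hlow : CycLowerBoundAt W 3 Dh :=
    cycLowerBoundAt_of_chiBranchLowerOdd_of_identity W 3 hmod hGZK haddv hr hp4 V hVW hV Dm.isNewformOf ϖ hϖ
      hdiv hlead hpgz
  exact missingLowerBoundAt_of_cycLowerBound_of_not_dvd_index W 3 hBι hSch
    (fun κ' γ hκ' hγ D ↦ TypeGOrd.isTorsion_three_of_delbourgo2002 hDel3 hG haddv hcm hκ' hγ D) hGZK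
    (by rw [hr]) v₀ hv₀ hcp0 hι hlow

end Three

/-- **Crux `GordTwoRankOne` OFF the Case-1 rows, every odd `p`, non-CM, ANOMALOUS OR NOT at `p = 3`**: the
all-`p` class form `gordTwoRankOne_offCaseOne_of_facts_of_chiBranchLower_of_branchCoeffOneNeZero`
(`…ClassForm.lean`) with its `p = 3` non-anomalous hypothesis REMOVED at the price of the extra published
binder `hCyc3` (`Disegni2017.delbourgoDatum_cycLineGrossZagier_intrinsicThree`). GRANTED the Λ-adic branch
lower containment DISPLAYED on the off-Case-1 slice (`hΛ` PLUS branch at `p ≡ 1 (mod 4)`, `hΛ'` MINUS branch at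
`p ≡ 3 (mod 4)`; NOT in print, NOT asserted), every off-Case-1 (G-ord, `e = 2`) row of analytic rank `1` with
`A′ ≠ 0` satisfies `ord_p #Ш(E)_an ≤ ord_p #Ш(E)`. [cite: Delbourgo2002, Theorem (A), (B) (p. 40), p. 67 (iv), p. 69]
[cite: Mazur1972Towers, Cor. 5.15] [cite: SkinnerUrban2014, Cor. 3.6.3, Thm. 3.6.4 (pp. 42–43) (shape only; nothing asserted)]
[cite: Miller2011LMS, Def. 1.1] -/
theorem gordTwoRankOne_offCaseOne_of_facts_intrinsic_of_chiBranchLower_of_branchCoeffOneNeZero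
    (hMaz : Mazur1972.cor515_universalNormIndex) (hCyc : delbourgoDatum_cycLineGrossZagier)
    (hCyc3 : delbourgoDatum_cycLineGrossZagier_intrinsicThree)
    (hArt : rankinSelbergEulerProductHecke_baseChangeDirichlet_eq) (h73 : GrossZagier1986_thm_I_7_3)
    (hWald : waldspurger_exists_heegnerField_twist_ne_zero) (hDel : Delbourgo2002.mainTheorem)
    (hDel3 : Delbourgo2002.mainTheorem_three)
    (hmod : hasEntireLFunction_rat) (hmodD : nonempty_modularParametrizationData)
    (hmodN : exists_isNewformOf) (hGZK : rank_eq_analyticRank_of_analyticRank_le_one)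
    (hΛ : ∀ (W : WeierstrassCurve ℚ) [W.IsElliptic] [W.IsGloballyMinimal] (p : ℕ) [Fact p.Prime],
      N10.CellGordTwo W p → ¬ HasCaseOneMember W p → p % 4 = 1 → ChiBranchLowerDivisibilityAt W p)
    (hΛ' : ∀ (W : WeierstrassCurve ℚ) [W.IsElliptic] [W.IsGloballyMinimal] (p : ℕ) [Fact p.Prime],
      N10.CellGordTwo W p → ¬ HasCaseOneMember W p → p % 4 = 3 → ChiBranchLowerDivisibilityOddAt W p) :
    ∀ (W : WeierstrassCurve ℚ) [W.IsElliptic] [W.IsGloballyMinimal] (p : ℕ) [Fact p.Prime],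
      W.analyticRank = 1 → N10.CellGordTwo W p → ¬ HasCaseOneMember W p → ¬ W.HasCM →
      BranchCoeffOneNeZeroAt W p → MissingLowerBoundAt W p := by
  intro W _ _ p hpF hr hc hm hcm hne
  by_cases hp3 : p = 3
  · subst hp3
    exact cellGordTwo_missingLowerBoundAt_rankOne_three_intrinsic_of_facts_of_chiBranchLowerOdd_of_branchCoeffOneNeZero
      hMaz hCyc3 hArt h73 hWald hDel3 hmod hmodD hmodN hGZK hc hcm hr (hΛ' W 3 hc hm (by norm_num)) hne
  · have hp5 : 5 ≤ p := hpF.out.five_le_of_ne_two_of_ne_three hc.1 hp3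
    have hodd : p % 4 = 1 ∨ p % 4 = 3 := by
      obtain ⟨k, hk⟩ := hpF.out.odd_of_ne_two hc.1
      omega
    rcases hodd with h1 | h3
    · exact cellGordTwo_missingLowerBoundAt_rankOne_of_facts_of_chiBranchLower_of_branchCoeffOneNeZero hMaz
        hCyc hArt h73 hWald hDel hmod hmodD hmodN hGZK hc h1 hcm hr (hΛ W p hc hm h1) hne
    · exact cellGordTwo_missingLowerBoundAt_rankOne_odd_of_facts_of_chiBranchLowerOdd_of_branchCoeffOneNeZero
        hMaz hCyc hArt h73 hWald hDel hmod hmodD hmodN hGZK hc h3 hp5 hcm hr (hΛ' W p hc hm h3) hne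

/-! ### §1 The Case-1 rows, rank one: gz's end states on the member ∘ Cassels -/

/-- **Cell (G-ord, `e = 2`), `r_an = 1`, `E` non-CM, the isogeny class HAS a Case-1 member, ANY odd `p`,
anomalous or not: the LOWER half `ord_p #Ш(E)_an ≤ ord_p #Ш(E)` from PUBLISHED named facts + the class's
analytic certificate** (`A′ ≠ 0` on the class). On the Case-1 member `W′` (globally minimal, X3♯(G-ord),
`e = 2`, `CaseOneDatum W′ p`): `p = 3` — gz's hna-free
`ClassX3Gord.bsdp_three_rankOne_of_facts_of_cycLineFactThree_intrinsic_of_lineDatum_of_branchCoeffOneNeZero`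
(`hCyc3`, `hDel3`, even-line lifting `hLiftE`); `p ≥ 5`, `p ≡ 1 (mod 4)` — `…_of_facts_of_cycLineFact_intrinsic_of_branchCoeffOneNeZero`;
`p ≡ 3 (mod 4)` — `…Odd` (all via `hMaz`); then Cassels (`hCassels`) through
`N10.missingLowerBoundAt_of_isIsogenous_of_bsdp`. Binders transported to the member by
`analyticRank_eq_of_isIsogenous'`, `hasCM_iff_of_isIsogenous`. Nothing booked.
[cite: Delbourgo2002, Theorem (A), (B) (p. 40), p. 67 (iv), p. 69] [cite: GreenbergVatsal2000, §2 (11), (16), pp. 28–30, §3 Thm. (3.12) p. 45]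
[cite: Wuthrich2014, Thm. 16 (p. 397)] [cite: Mazur1972Towers, Cor. 5.15] [cite: MilneADT2006, Thm. I.7.3]
[cite: Miller2011LMS, Def. 1.1] -/
theorem gordTwoRankOne_caseOne_of_facts_of_classCert
    (hW16 : Wuthrich2014.thm16_halfEigenCharIdeal_dvd_cyclotomicPrime)
    (hGV : thm312_branch_unitContent_and_lambda_eq_residual_goodOrd)
    (h23 : datumSelmer_nonPrimitive_invariants)
    (h414 : Greenberg1999.prop414_noFiniteSubmodule_of_not_dvd_torsionOrder)
    (hGrK : Greenberg1999.imKummer_ge_strictCondition_goodOrdinary)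
    (hLiftF : residualEpsilon_surjOn_of_lineRamifiedEven) (hLiftE : residualEpsilon_surjOn_of_lineEven)
    (hMaz : Mazur1972.cor515_universalNormIndex) (hCyc : delbourgoDatum_cycLineGrossZagier)
    (hCyc3 : delbourgoDatum_cycLineGrossZagier_intrinsicThree)
    (hArt : rankinSelbergEulerProductHecke_baseChangeDirichlet_eq) (h73 : GrossZagier1986_thm_I_7_3)
    (hWald : waldspurger_exists_heegnerField_twist_ne_zero) (hDel : Delbourgo2002.mainTheorem)
    (hDel3 : Delbourgo2002.mainTheorem_three)
    (hmod : hasEntireLFunction_rat) (hmodD : nonempty_modularParametrizationData)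
    (hmodN : exists_isNewformOf) (hGZK : rank_eq_analyticRank_of_analyticRank_le_one)
    (hCassels : bsdRHS_eq_of_isIsogenous) :
    ∀ (W : WeierstrassCurve ℚ) [W.IsElliptic] [W.IsGloballyMinimal] (p : ℕ) [Fact p.Prime],
      W.analyticRank = 1 → N10.CellGordTwo W p → ¬ W.HasCM →
      (∀ (W' : WeierstrassCurve ℚ) [W'.IsElliptic] [W'.IsGloballyMinimal],
        IsIsogenous W W' → BranchCoeffOneNeZeroAt W' p) →
      HasCaseOneMember W p → MissingLowerBoundAt W p := by
  intro W _ _ p hpF hr hc hcm hne hmem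
  obtain ⟨W', hE', hM', hiso, hX', he', hdat⟩ := hmem
  haveI := hE'
  haveI := hM'
  have hr' : W'.analyticRank = 1 := by rw [← analyticRank_eq_of_isIsogenous' hiso]; exact hr
  have hle : W.analyticRank ≤ 1 := by rw [hr]
  have hcm' : ¬ W'.HasCM := fun h ↦ hcm ((hasCM_iff_of_isIsogenous hiso).mpr h)
  have hne' : BranchCoeffOneNeZeroAt W' p := hne W' hiso
  rcases hdat with ⟨hp3, hL⟩ | ⟨hp5, Φ₀, hΦ, hram0, heven, hram⟩
  · subst hp3
    exact N10.missingLowerBoundAt_of_isIsogenous_of_bsdp 3 hCassels hGZK hmod hiso hle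
      (ClassX3Gord.bsdp_three_rankOne_of_facts_of_cycLineFactThree_intrinsic_of_lineDatum_of_branchCoeffOneNeZero
        hW16 hGV h23 h414 hGrK hLiftE hMaz hCyc3 hArt h73 hWald hDel3 hmod hmodD hmodN hGZK hX' hcm' hr' hL
        hne')
  · have hodd : p % 4 = 1 ∨ p % 4 = 3 := by
      obtain ⟨k, hk⟩ := hpF.out.odd_of_ne_two hc.1
      omega
    rcases hodd with h1 | h3
    · exact N10.missingLowerBoundAt_of_isIsogenous_of_bsdp p hCassels hGZK hmod hiso hle
        (ClassX3Gord.bsdp_rankOne_of_facts_of_cycLineFact_intrinsic_of_branchCoeffOneNeZero hW16 hGV h23 h414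
          hGrK hLiftF hMaz hCyc hArt h73 hWald hDel hmod hmodD hmodN hGZK hX' he' h1 hcm' hr' Φ₀ hΦ hram0
          heven hram hne')
    · exact N10.missingLowerBoundAt_of_isIsogenous_of_bsdp p hCassels hGZK hmod hiso hle
        (ClassX3Gord.bsdp_rankOne_of_facts_of_cycLineFact_intrinsic_of_branchCoeffOneNeZeroOdd hW16 hGV h23
          h414 hGrK hLiftF hMaz hCyc hArt h73 hWald hDel hmod hmodD hmodN hGZK hX' he' h3 hp5 hcm' hr' Φ₀ hΦ
          hram0 heven hram hne')

/-! ### §2 THE CRUX SHAPE: `GordTwoRankOne` modulo exactly its displayed residual inputs -/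

/-- **Crux `GordTwoRankOne` (item 19358) MODULO its displayed inputs.** From PUBLISHED named facts (the route's
`PrintedFacts`/`ReadingFacts` binders `hW16 hGV h23 h414 hGrK hLiftF hLiftE hDel hDel3 hmod hmodD hmodN hGZK
hCassels`, Mazur 1972 Cor. 5.15 `hMaz`, lit's conjoined facts (B) `hCyc` / `hCyc3`, Artin formalism `hArt`,
Gross–Zagier I.(7.3) `h73`, Waldspurger `hWald`) and the Λ-adic branch lower containment DISPLAYED on the
off-Case-1 slice (`hΛ` PLUS branch at `p ≡ 1 (mod 4)`, `hΛ'` MINUS branch at `p ≡ 3 (mod 4)`; the rank-free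
Λ-adic layer of crux `GordTwoRankZeroOffCaseOne` = items 19244/19245 — NOT in print, NOT asserted): for every
globally minimal `E/ℚ` of analytic rank `1` and every (G-ord, `e = 2`) additive odd prime `p` (anomalous or
not, any residual image), IF `E` is non-CM and the branch has a simple zero on the isogeny class (`A′ ≠ 0`:
`BranchCoeffOneNeZeroAt W′ p` for every `W′ ~ W` — one number per class, = Schneider's non-degeneracy for the
datum), THEN `ord_p #Ш(E)_an ≤ ord_p #Ш(E)`. Excluded middle on `HasCaseOneMember W p`: §1 (Case-1) / §0's
off-Case-1 form (certificate at `W` itself via `isIsogenous_self`). The route decl is this with the three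
displayed inputs (hΛ/hΛ', ¬CM, the class certificate) discharged; nothing here discharges them. Nothing booked.
[cite: Delbourgo2002, Theorem (A), (B) (p. 40), p. 67 (iv), p. 69] [cite: Disegni2017, Theorem A/B (arXiv v3 PDF 7–9)]
[cite: Mazur1972Towers, Cor. 5.15] [cite: MilneADT2006, Thm. I.7.3]
[cite: SkinnerUrban2014, Cor. 3.6.3, Thm. 3.6.4 (pp. 42–43) (shape only; nothing asserted)] [cite: Miller2011LMS, Def. 1.1] -/
theorem gordTwoRankOne_of_facts_of_chiBranchLower_of_classCert
    (hW16 : Wuthrich2014.thm16_halfEigenCharIdeal_dvd_cyclotomicPrime)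
    (hGV : thm312_branch_unitContent_and_lambda_eq_residual_goodOrd)
    (h23 : datumSelmer_nonPrimitive_invariants)
    (h414 : Greenberg1999.prop414_noFiniteSubmodule_of_not_dvd_torsionOrder)
    (hGrK : Greenberg1999.imKummer_ge_strictCondition_goodOrdinary)
    (hLiftF : residualEpsilon_surjOn_of_lineRamifiedEven) (hLiftE : residualEpsilon_surjOn_of_lineEven)
    (hMaz : Mazur1972.cor515_universalNormIndex) (hCyc : delbourgoDatum_cycLineGrossZagier)
    (hCyc3 : delbourgoDatum_cycLineGrossZagier_intrinsicThree)
    (hArt : rankinSelbergEulerProductHecke_baseChangeDirichlet_eq) (h73 : GrossZagier1986_thm_I_7_3)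
    (hWald : waldspurger_exists_heegnerField_twist_ne_zero) (hDel : Delbourgo2002.mainTheorem)
    (hDel3 : Delbourgo2002.mainTheorem_three)
    (hmod : hasEntireLFunction_rat) (hmodD : nonempty_modularParametrizationData)
    (hmodN : exists_isNewformOf) (hGZK : rank_eq_analyticRank_of_analyticRank_le_one)
    (hCassels : bsdRHS_eq_of_isIsogenous)
    (hΛ : ∀ (W : WeierstrassCurve ℚ) [W.IsElliptic] [W.IsGloballyMinimal] (p : ℕ) [Fact p.Prime],
      N10.CellGordTwo W p → ¬ HasCaseOneMember W p → p % 4 = 1 → ChiBranchLowerDivisibilityAt W p)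
    (hΛ' : ∀ (W : WeierstrassCurve ℚ) [W.IsElliptic] [W.IsGloballyMinimal] (p : ℕ) [Fact p.Prime],
      N10.CellGordTwo W p → ¬ HasCaseOneMember W p → p % 4 = 3 → ChiBranchLowerDivisibilityOddAt W p) :
    ∀ (W : WeierstrassCurve ℚ) [W.IsElliptic] [W.IsGloballyMinimal] (p : ℕ) [Fact p.Prime],
      W.analyticRank = 1 → N10.CellGordTwo W p → ¬ W.HasCM →
      (∀ (W' : WeierstrassCurve ℚ) [W'.IsElliptic] [W'.IsGloballyMinimal],
        IsIsogenous W W' → BranchCoeffOneNeZeroAt W' p) →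
      MissingLowerBoundAt W p := by
  intro W _ _ p _ hr hc hcm hne
  by_cases hm : HasCaseOneMember W p
  · exact gordTwoRankOne_caseOne_of_facts_of_classCert hW16 hGV h23 h414 hGrK hLiftF hLiftE hMaz hCyc hCyc3
      hArt h73 hWald hDel hDel3 hmod hmodD hmodN hGZK hCassels W p hr hc hcm hne hm
  · exact gordTwoRankOne_offCaseOne_of_facts_intrinsic_of_chiBranchLower_of_branchCoeffOneNeZero hMaz hCyc
      hCyc3 hArt h73 hWald hDel hDel3 hmod hmodD hmodN hGZK hΛ hΛ' W p hr hc hm hcm (hne W (isIsogenous_self W))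

end Summit.BirchSwinnertonDyer.BirchSwinnertonDyer.Theorems.AdditiveBranchIMCGordTwoRankOne

end
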